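import Summits.BirchSwinnertonDyer.BirchSwinnertonDyer.Theorems.UniversalToricDescentDefectTransportLambda
import HarnessLib

/-!
# Route UniversalToricDescent — the WALL STEP of act D's ♭T `DefectTransportModThree`:
# `(𝓛) ⊆ Ch_Λ(X)·R₀⟦T⟧` and `μ(𝓛) = 0` force `μ(X) = 0`; hence the algebraic half of ♭T consumes
# exactly ♭T's hypotheses «`X_{∅,0}(E)` torsion, the wall inclusion at the `E`-frame `𝓛`» plus `μ(𝓛) = 0`

Lead prover bsd-wall-utd-p1 g11 (`--supports` ♭T stmt-BirchSwinnertonDyer-26042; sequel of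
`UniversalToricDescentDefectTransportLambda`). ♭T hands the prover, at the `E`-frame `𝓛`: `Λ`-torsion of
`X = X_{∅,0}(E/K_∞)` and the wall's inclusion `(𝓛) ⊆ Ch_Λ(X)·R₀⟦T⟧`; the algebraic half landed so far
(`defectTransport_algebraicHalf_lambda`) starts instead from «`Ch·R₀⟦T⟧ = (g)`, `profile_n(g)`», i.e. from
`μ(X) = 0`. This file closes that gap:

* `muInvariant_eq_zero_of_span_le_map_charIdeal` — for a finitely generated torsion `Λ`-module `M` and
  `L ∈ R₀⟦T⟧` with a norm-one coefficient: `(L) ⊆ Ch_Λ(M)·R₀⟦T⟧ ⟹ μ(M) = 0` (if `p ∣ f_M` then `p` divides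
  every coefficient of `L`; generalises `muInvariant_eq_zero_of_map_charIdeal_eq_span`, which needs equality);
* **`defectTransport_algebraicHalf_lambda_of_wall`** — the algebraic half of ♭T from ♭T's OWN hypotheses
  (torsion + wall inclusion at `𝓛`) plus `μ(𝓛) = 0` (+ (iv), Poitou–Tate ×2, base finiteness for `E`, `E′`):
  generators `g`, `g′` of `Ch(E)·R₀⟦T⟧`, `Ch(E′)·R₀⟦T⟧` with norm profiles `λ_alg(E)`, `λ_alg(E′)`, the twin's
  torsion, and `λ_alg(E) + Σ_{v∈Σ} 3^{c_v}·s_v(E) = λ_alg(E′) + Σ_{v∈Σ} 3^{c_v}·s_v(E′)`.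

So ♭T = its ANALYTIC half (the `Σ`-depleted congruence supplying `μ(𝓛_E) = 0` and
`m + Σ_v 3^{c_v} d_v(E) = m′ + Σ_v 3^{c_v} d_v(E′)`; unprinted at `27 ∣ N`) modulo {Poitou–Tate ×2, (iv) off the
206 split classes, base finiteness at `v ∣ 3` for `E` over the (arbitrary Heegner) `K` and for `E′`}, using
`s_v = d_v` (`…LocalTermClosedForm`). THEOREMS ONLY; no definition, no named fact, no `sorry`. BSD is not
advanced by this file. References: [GreenbergVatsal2000] p. 2 (1)–(2), Thm. (1.4); [Washington1997] §13.2.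
-/

set_option autoImplicit false
-- `…BirchSwinnertonDyer.BirchSwinnertonDyer.Theorems…` is the problem's mandated namespace (D-0017).
set_option linter.dupNamespace false

noncomputable section

open scoped Classical

namespace Summit.BirchSwinnertonDyer.BirchSwinnertonDyer.Theorems.UniversalToricDescentDefectTransport

/-! ### §1 `Λ`-algebra: an ideal above a `μ = 0` series has `μ = 0` -/

section Currency

open Literature.NumberTheory.EllipticCurves Literature.NumberTheory.EllipticCurves.IwasawaAlgebra
  Literature.NumberTheory.EllipticCurves.IwasawaModuleFinitePadicInt
  Summit.BirchSwinnertonDyer.Rank1Residual.X11b Summit.BirchSwinnertonDyer.Rank1Residual.X11b.AcSelmer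
  Summit.BirchSwinnertonDyer.BirchSwinnertonDyer.Theorems.UniversalToricDescentAcDualMuZero

variable {p : ℕ} [hp : Fact p.Prime]
variable (M : Type*) [AddCommGroup M] [Module (IwasawaAlgebra p) M] [Module.Finite (IwasawaAlgebra p) M]

/-- **`(L) ⊆ Ch_Λ(M)·R₀⟦T⟧` with a norm-one coefficient of `L` ⟹ `μ(M) = 0`** (finitely generated torsion
`M`): with `Ch_Λ(M) = (f)` (principal), `L = u·f^♮`; if `p ∣ f` in `Λ` (i.e. `μ ≠ 0`,
`muInvariant_eq_zero_iff_not_C_dvd_of_charIdeal_eq_span`) then `p` divides every coefficient of `L` in `R₀`,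
so all have norm `≤ ‖p‖ < 1`. [cite: GreenbergVatsal2000, p. 2, (1)–(2)] [cite: Washington1997, §13.2] -/
theorem muInvariant_eq_zero_of_span_le_map_charIdeal (hM : Module.IsTorsion (IwasawaAlgebra p) M)
    {L : UnrSeries p}
    (hle : Ideal.span {L} ≤ (Module.charIdeal (IwasawaAlgebra p) M).map (PowerSeries.map (Halves.toUnr p)))
    (hi : ∃ i : ℕ, ‖((PowerSeries.coeff i L : unrIntegers p) : ℂ_[p])‖ = 1) :
    muInvariant p M = 0 := by
  obtain ⟨f, hf⟩ := (charIdeal_isPrincipal_holds p M).principal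
  have hf' : Module.charIdeal (IwasawaAlgebra p) M = Ideal.span {f} := hf
  rw [muInvariant_eq_zero_iff_not_C_dvd_of_charIdeal_eq_span M hM hf']
  rintro ⟨h, rfl⟩
  obtain ⟨i, hi⟩ := hi
  rw [hf', map_span_singleton_toUnr] at hle
  -- `L = u · (p · h)^♮` for some `u ∈ R₀⟦T⟧`
  obtain ⟨u, hu⟩ := Ideal.mem_span_singleton'.mp (hle (Ideal.mem_span_singleton_self L))
  have hmap : PowerSeries.map (Halves.toUnr p) (PowerSeries.C (p : ℤ_[p]) * h) =
      PowerSeries.C (Halves.toUnr p (p : ℤ_[p])) * PowerSeries.map (Halves.toUnr p) h := by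
    rw [map_mul, PowerSeries.map_C]
  have hcoeff : PowerSeries.coeff i L = Halves.toUnr p (p : ℤ_[p]) *
      PowerSeries.coeff i (PowerSeries.map (Halves.toUnr p) h * u) := by
    rw [← hu, hmap, mul_comm u, mul_assoc, PowerSeries.coeff_C_mul]
  have hlt : ‖((PowerSeries.coeff i L : unrIntegers p) : ℂ_[p])‖ < 1 := by
    rw [hcoeff, Subring.coe_mul, norm_mul, norm_coe_toUnr]
    calc ‖(p : ℤ_[p])‖ * ‖((PowerSeries.coeff i (PowerSeries.map (Halves.toUnr p) h * u) :
            unrIntegers p) : ℂ_[p])‖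
        ≤ ‖(p : ℤ_[p])‖ * 1 :=
          mul_le_mul_of_nonneg_left (Halves.norm_coe_unrIntegers_le_one p _) (norm_nonneg _)
      _ < 1 := by rw [mul_one, PadicInt.norm_p]; exact inv_lt_one_of_one_lt₀ (by exact_mod_cast hp.out.one_lt)
  exact absurd hi hlt.ne

end Currency

/-! ### §2 The algebraic half of ♭T from ♭T's own hypotheses + `μ(𝓛_E) = 0` -/

section Route

open Function Field NumberField IsDedekindDomain WeierstrassCurve
open Literature.NumberTheory.GaloisRepresentations Literature.NumberTheory.EllipticCurves
  Literature.NumberTheory.EllipticCurves.GreenbergSelmer Literature.NumberTheory.GaloisCohomology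
  Literature.NumberTheory.EllipticCurves.IwasawaAlgebra Literature.NumberTheory.EllipticCurves.Rank1Residual
  Summit.BirchSwinnertonDyer.Rank1Residual Summit.BirchSwinnertonDyer.Rank1Residual.X11b
  Summit.BirchSwinnertonDyer.Rank1Residual.X11b.Coinv Summit.BirchSwinnertonDyer.Rank1Residual.X11b.AcSelmer
  Summit.BirchSwinnertonDyer.Rank1Residual.X11b.LocBridge Summit.BirchSwinnertonDyer.Rank1Residual.Iwasawa
  Summit.BirchSwinnertonDyer.BirchSwinnertonDyer.Theorems.UniversalToricDescentSigmaPassage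
  Summit.BirchSwinnertonDyer.BirchSwinnertonDyer.Theorems.UniversalToricDescentNoFiniteSubmodule
  Summit.BirchSwinnertonDyer.BirchSwinnertonDyer.Theorems.UniversalToricDescentSigmaLocalImage
  Summit.BirchSwinnertonDyer.BirchSwinnertonDyer.Theorems.UniversalToricDescentLambdaNormProfile

/-- **The algebraic half of ♭T from the wall**, direction `E → E′`: ♭T binders, `X_{∅,0}(E/K_∞)` torsion
(`hT`), the wall's inclusion `(𝓛) ⊆ Ch(E)·R₀⟦T⟧` at the `E`-frame (`hle`), a norm-one coefficient of `𝓛`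
(`hi`, = `μ(𝓛) = 0`, the analytic half's output), (iv), Poitou–Tate ×2 and base finiteness at `v ∣ 3` for `E`
and `E′` ⟹ the finite bad set `Σ`, exact indices `c_v`, local exponents `s_v(E)`, `s_v(E′)`, generators of both
characteristic ideals with norm profiles `λ_alg(E)`, `λ_alg(E′)`, the twin's torsion, and
`λ_alg(E) + Σ_{v∈Σ} 3^{c_v} s_v(E) = λ_alg(E′) + Σ_{v∈Σ} 3^{c_v} s_v(E′)`.
[cite: GreenbergVatsal2000, Thm. (1.4), §2 Prop. (2.4) and (2.10) (pp. 23–28)] [cite: Brink2007, Thm. 2 and Cor. 1] -/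
theorem defectTransport_algebraicHalf_lambda_of_wall (W W' : WeierstrassCurve ℚ) [W.IsElliptic]
    [W.IsGloballyMinimal] [W'.IsElliptic] [W'.IsGloballyMinimal] {N N' : ℕ} (K : Type) [Field K]
    [NumberField K]
    (hO6 : Additive.ClassO6 W 3) (hN : W.conductorNorm ℤ = N) (hcong : O6.ModPCongruent W' W 3)
    (hN' : W'.conductorNorm ℤ = N') (hK : IsImaginaryQuadratic K)
    (hHe : SatisfiesHeegnerHypothesis N K) (hHe' : SatisfiesHeegnerHypothesis N' K)
    (κ : ZpExtension K 3) (hκ : κ.IsAnticyclotomic) (γ : absoluteGaloisGroup K)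
    [Fact (κ.IsTopGenerator γ)] {𝔭' : HeightOneSpectrum (𝓞 K)} (h𝔭' : ((3 : ℕ) : 𝓞 K) ∈ 𝔭'.asIdeal)
    (hT : Module.IsTorsion (IwasawaAlgebra 3) (XAc (W.baseChange K) 3 κ 𝔭' ∅ γ))
    {L : UnrSeries 3}
    (hle : Ideal.span {L} ≤
      (XAc.charIdeal (W.baseChange K) 3 κ 𝔭' ∅ γ).map (PowerSeries.map (Halves.toUnr 3)))
    (hi : ∃ i : ℕ, ‖((PowerSeries.coeff i L : unrIntegers 3) : ℂ_[3])‖ = 1)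
    (h4 : ∀ R : (W.baseChange ℚ_[3]).toAffine.Point, 3 • R = 0 → R = 0)
    (hPT : poitouTate_selmerStructure_duality K) (hPT2 : poitouTate_sha_tateDual K)
    (hfin : ∀ v : HeightOneSpectrum (𝓞 K), ((3 : ℕ) : 𝓞 K) ∈ v.asIdeal →
      Finite (selmerAcBase (W.baseChange K) 3 v ∅))
    (hfin' : ∀ v : HeightOneSpectrum (𝓞 K), ((3 : ℕ) : 𝓞 K) ∈ v.asIdeal →
      Finite (selmerAcBase (W'.baseChange K) 3 v ∅)) :
    ∃ (T : Finset (HeightOneSpectrum (𝓞 K))) (c s s' : HeightOneSpectrum (𝓞 K) → ℕ),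
      (↑T = {v : HeightOneSpectrum (𝓞 K) | ((3 : ℕ) : 𝓞 K) ∉ v.asIdeal ∧
        (¬ (W.baseChange K).HasGoodReductionAt v ∨ ¬ (W'.baseChange K).HasGoodReductionAt v)}) ∧
      (∀ v ∈ T, (∃ d₀ : decomp (K := K) v, (κ (d₀ : absoluteGaloisGroup K)).toAdd = (3 : ℤ_[3]) ^ c v) ∧
        (∀ d : decomp (K := K) v, (3 : ℤ_[3]) ^ c v ∣ (κ (d : absoluteGaloisGroup K)).toAdd) ∧
        Nat.card {f : subgroupH1 (kerD κ v) ((W.baseChange K).geomPrimaryTorsion 3) // 3 • f = 0} =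
          3 ^ s v ∧
        Nat.card {f : subgroupH1 (kerD κ v) ((W'.baseChange K).geomPrimaryTorsion 3) // 3 • f = 0} =
          3 ^ s' v) ∧
      (∃ g : UnrSeries 3,
        (XAc.charIdeal (W.baseChange K) 3 κ 𝔭' ∅ γ).map (PowerSeries.map (Halves.toUnr 3)) =
            Ideal.span {g} ∧
          (∀ i < lambdaInvariant 3 (XAc (W.baseChange K) 3 κ 𝔭' ∅ γ),
            ‖((PowerSeries.coeff i g : unrIntegers 3) : ℂ_[3])‖ < 1) ∧
          ‖((PowerSeries.coeff (lambdaInvariant 3 (XAc (W.baseChange K) 3 κ 𝔭' ∅ γ)) g :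
            unrIntegers 3) : ℂ_[3])‖ = 1) ∧
      Module.IsTorsion (IwasawaAlgebra 3) (XAc (W'.baseChange K) 3 κ 𝔭' ∅ γ) ∧
      (∃ g' : UnrSeries 3,
        (XAc.charIdeal (W'.baseChange K) 3 κ 𝔭' ∅ γ).map (PowerSeries.map (Halves.toUnr 3)) =
            Ideal.span {g'} ∧
          (∀ i < lambdaInvariant 3 (XAc (W'.baseChange K) 3 κ 𝔭' ∅ γ),
            ‖((PowerSeries.coeff i g' : unrIntegers 3) : ℂ_[3])‖ < 1) ∧
          ‖((PowerSeries.coeff (lambdaInvariant 3 (XAc (W'.baseChange K) 3 κ 𝔭' ∅ γ)) g' :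
            unrIntegers 3) : ℂ_[3])‖ = 1) ∧
      lambdaInvariant 3 (XAc (W.baseChange K) 3 κ 𝔭' ∅ γ) + ∑ v ∈ T, 3 ^ c v * s v =
        lambdaInvariant 3 (XAc (W'.baseChange K) 3 κ 𝔭' ∅ γ) + ∑ v ∈ T, 3 ^ c v * s' v := by
  haveI : Fact (Nat.Prime 3) := ⟨Nat.prime_three⟩
  haveI := XAc.module_finite κ 𝔭' (∅ : Set (HeightOneSpectrum (𝓞 K))) γ Set.finite_empty
    (W := W.baseChange K)
  -- the wall step: `μ(X_E) = 0`
  have hμ : muInvariant 3 (XAc (W.baseChange K) 3 κ 𝔭' ∅ γ) = 0 :=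
    muInvariant_eq_zero_of_span_le_map_charIdeal (XAc (W.baseChange K) 3 κ 𝔭' ∅ γ) hT hle hi
  -- a generator with profile `λ_alg(E)`
  obtain ⟨g, hg, hglt, hgeq⟩ :=
    exists_generator_normProfile_lambdaInvariant (W.baseChange K) 3 κ 𝔭' ∅ γ Set.finite_empty hT hμ
  obtain ⟨T, c, s, s', hTS, hcT, hT', hg', hsum⟩ :=
    defectTransport_algebraicHalf_lambda W W' K hO6 hN hcong hN' hK hHe hHe' κ hκ γ h𝔭' hT hg ⟨hglt, hgeq⟩ h4
      hPT hPT2 hfin hfin'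
  exact ⟨T, c, s, s', hTS, hcT, ⟨g, hg, hglt, hgeq⟩, hT', hg', hsum⟩

end Route

end Summit.BirchSwinnertonDyer.BirchSwinnertonDyer.Theorems.UniversalToricDescentDefectTransport

end
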